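import Literature.NumberTheory.LFunctions.Zhang2022.Section9Ded97
import HarnessLib

/-!
# Zhang (2022) §9: the step `Z22:§9.u002` discharged from the tree's Lemma 8.2

Y. Zhang, *Discrete mean estimates and the Landau–Siegel zero*, arXiv:2211.02515v1 (2022)
[Zhang2022LandauSiegel] — an unrefereed manuscript under adjudication. §9 p. 51 (tex L2605–2608):
"By Lemma 8.2 and 8.4, for `dr < P₃/T`,
`Σ_m χ(m)ϰ₃(drm)/m^{1−β_j} = (L′(1,χ)/log P₃)𝔣_{j6}(P₃/dr) + O(𝓛⁻⁶)`" — typed as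
`Section9Statements.Step9u002 c'` (slice L2-t10, p412071). The inference "Lemma 8.2 ⇒ this display"
is the discharge prover sz-d17's kernel edge `Section9Discharge.ded9u002_holds : Ded9u002 c'`
(`Section9Ded97`, p413634), and Lemma 8.2 itself is a theorem of the tree for `c′ ≥ 0`
(`Skeleton.lemma82_holds`, via `Lemma82.lemma_8_2`). Composing the two closes the node outright.
THEOREM-ONLY; 0 definitions, 0 facts; nothing about Theorems 1–2 of the manuscript.

## References

* Y. Zhang, arXiv:2211.02515v1 (2022), §9 p. 51; §8 Lemma 8.2 p. 45. [cite: Zhang2022LandauSiegel, §9]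
-/

namespace Literature.NumberTheory.LFunctions.Zhang2022.Section9Statements

/-- **`Z22:§9.u002` DISCHARGED for `c′ ≥ 0`**: "for `dr < P₃/T`,
`Σ_m χ(m)ϰ₃(drm)m^{β_j−1} = (L′(1,χ)/log P₃)𝔣_{j6}(P₃/dr) + O(𝓛⁻⁶)`" holds (under (A), for all large `D`),
from the tree's Lemma 8.2 (`Skeleton.lemma82_holds`) through sz-d17's edge `Section9Discharge.ded9u002_holds`.
[cite: Zhang2022LandauSiegel, §9 p.51, tex L2606] -/
theorem step9u002_holds {c' : ℝ} (hc' : 0 ≤ c') : Step9u002 c' :=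
  Section9Discharge.ded9u002_holds c' (Skeleton.lemma82_holds hc')

end Literature.NumberTheory.LFunctions.Zhang2022.Section9Statements
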